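import Literature.IUT.LogThetaLattice.LogStripOfKits

/-!
# Non-vacuity: `StripFrame.ofKits` over abc-iut-L5-t4's TOY kits (consistency witness for the B10 part 2 assembly)

Mochizuki, *Inter-universal Teichmüller Theory III*, kurims manuscript (May 2020), Def 1.1 p. 23, Prop 1.2 (i) p. 31;
*I* (May 2020), Def 5.2 pp. 134–135, Def 6.11 (iii) p. 173 (toy models: abc-iut-L5-t4's `PMBaseKit.toyKit`,
`MultKit.toy`, `FKit.toy`, abc-iut-L5-d4's `MonoLaws.toy`, `isomFtoDBijective_toy`, `isomFmtoDmSurjective_toy`,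
`rlfOfIsStrip_toy`). ([IUTchIII] Def 1.1 p.23) [claim: Mochizuki2012, status: disputed]. KIT-RULE witness (plan/L6
ASSIGNMENTS G11/G12): the assembly `StripFrame.ofKits` of `StripFrameOfKits.lean` has an HONEST INHABITANT — over
the toy kits (one valuation, ambient category `Model.Obj l`, one-object `𝒟^⊢`-groupoid), with the three NAMED
hypotheses ([IUTchI] Cor 5.3 (ii), (iii); Rmk 5.2.1 (ii)) DISCHARGED by abc-iut-L5-d4's toy theorems, a `TimesMuSide`
whose `×μ`-categories are the toy `𝒟^⊢`-groupoid / the toy `ℱ^⊩`-strips, and a `Θ^{±ell}`-Hodge theater over the toy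
`ℱ`-kit lifted from the model base theater `Ex62.ht` of [IUTchI] Def 6.4 (iii) — so `StripFrame.ofKits` and every
[IUTchIII] §1 construction over it (`LogStripData.ofKits`, the full log-link, Prop 1.2 (i)) are jointly
satisfiable. Nothing of the series is asserted; consistency ≠ endorsement.
-/

noncomputable section

namespace Literature.IUT.LogThetaLattice

open CategoryTheory
open Literature.IUT.HodgeTheaters Literature.IUT.HodgeTheaters.PMBaseKit

namespace KitsToy

variable (l : ℕ) [Fact l.Prime] (hl : l ≠ 2)

/-- **IUTchII:Def4.9(vii)** (kurims p.158) A toy `TimesMuSide` over abc-iut-L5-t4's toy kits: `F^{⊢×μ} := F^{⊢▶×μ} :=` the one-object toy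
`𝒟^⊢`-groupoid (so `F^⊢ ↦ F^{⊢×μ}` is `assocDmFunctor` and `F^{⊢×μ} ↦ D^⊢` the identity), `F^{⊩▶×μ} :=` the toy
`ℱ^⊩`-prime-strips. ([IUTchII] Def 4.9 (vii) p.158) [claim: Mochizuki2012, status: disputed] -/
def timesMuSide : TimesMuSide (FKit.toy l hl) (FKit.MonoLaws.toy l hl) where
  Fxm := (MultKit.toy l hl).DMono
  Fvtxm := (MultKit.toy l hl).DMono
  Fglxm := (FKit.toy l hl).FrStrip
  FvToFxm := PrimeStripGroupoids.assocDmFunctor (FKit.MonoLaws.toy l hl)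
  FxmToDv := 𝟭 _
  FglToFglxm := 𝟭 _
  FglxmToFvtxm := PrimeStripGroupoids.rlfFmFunctor (FKit.toy l hl)
      (FKit.nonempty_rlfFm_rlfModel_iso_of_rlfOfIsStrip (FKit.rlfOfIsStrip_toy l hl)) ⋙
    PrimeStripGroupoids.assocDmFunctor (FKit.MonoLaws.toy l hl)
  FvtxmToFxm := 𝟭 _
  fxm_comm := Functor.rightUnitor _
  iso_nonempty_Fxm _ _ := ⟨Iso.refl _⟩
  iso_nonempty_Fglxm := PrimeStripGroupoids.iso_nonempty_FrStrip

/-- **IUTchIII:Def1.1** (kurims p.23) **The toy frame**: `StripFrame.ofKits` over the toy kits, with [IUTchI] Cor 5.3 (ii), (iii) and Rmk 5.2.1 (ii)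
DISCHARGED by abc-iut-L5-d4's `isomFtoDBijective_toy`, `isomFmtoDmSurjective_toy`, `rlfOfIsStrip_toy`.
([IUTchIII] Def 1.1 p.23) [claim: Mochizuki2012, status: disputed] -/
def frame : StripFrame.{1} :=
  StripFrame.ofKits (FKit.MonoLaws.toy l hl) (FKit.isomFtoDBijective_toy l hl) (FKit.isomFmtoDmSurjective_toy l hl)
    (FKit.rlfOfIsStrip_toy l hl) (timesMuSide l hl)

/-- **IUTchIII:Def1.1(i)** (kurims p.24) A toy log-Frobenius datum: `log := 𝟭` at every place (base object unchanged).
([IUTchIII] Def 1.1 (i) p.24) [claim: Mochizuki2012, status: disputed] -/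
def logKit : LogKit (FKit.toy l hl) where
  log _ := 𝟭 _
  log_model _ := ⟨Iso.refl _⟩
  logD v := ((FKit.toy l hl).toD v).leftUnitor

/-- **IUTchIII:Def1.1(iii)** (kurims p.26) The §1 log-strip interface over the toy frame. ([IUTchIII] Def 1.1 (iii) p.26) [claim: Mochizuki2012, status: disputed] -/
def logStripData : LogStripData (frame l hl) :=
  LogStripData.ofKits _ _ _ _ _ (logKit l hl)

/-- **IUTchI:Def6.11(iii)** (kurims p.173) A `Θ^{±ell}`-Hodge theater over the toy `ℱ`-kit: the model base theater
`(𝔇_≻ ⟵ 𝔇_± ⟶ 𝒟^{⊚±})` of [IUTchI] Def 6.4 (iii) (abc-iut-L5-t4's `Ex62.ht`) with every `ℱ`-prime-strip the tautological one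
(over the toy kit `ℱ ↦ 𝒟` is the identity). ([IUTchI] Def 6.11 (iii) p.173) [claim: Mochizuki2012, status: disputed] -/
def thetaPMEllHT : (FKit.toy l hl).ThetaPMEllHT where
  T := ZMod l
  grpT := FlPMGroup.tautological l
  capsule _ := ⟨fun v => (FKit.toy l hl).fModel v, fun _ => ⟨Iso.refl _⟩⟩
  codomain := ⟨fun v => (FKit.toy l hl).fModel v, fun _ => ⟨Iso.refl _⟩⟩
  glob := (toyKit l hl).gModel
  dPolyPM := Ex62.poly (toyKit l hl)
  dPolyEll := Ex63.poly (toyKit l hl)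
  exists_model := (Ex62.ht (K := toyKit l hl)).exists_model

/-- **IUTchI:Def6.11(iii)** (kurims p.173) The Hodge-theater category of the toy frame is inhabited. ([IUTchI] Def 6.11 (iii) p.173) [claim: Mochizuki2012, status: disputed] -/
theorem nonempty_HT : Nonempty (frame l hl).HT := ⟨AsSmall.up.obj (HTRep.of (thetaPMEllHT l hl))⟩

/-- **IUTchIII:Def1.1** (kurims p.23) The `ℱ`-prime-strip category of the toy frame is inhabited. ([IUTchIII] Def 1.1 p.23) [claim: Mochizuki2012, status: disputed] -/
theorem nonempty_F : Nonempty (frame l hl).F := ⟨AsSmall.up.obj (thetaPMEllHT l hl).codomain⟩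

/-- **IUTchIII:Prop1.2(i)** (kurims p.31) Prop 1.2 (i) holds, non-vacuously, over the toy frame: the full log-link between two toy
`ℱ`-prime-strips induces the full poly-isomorphism of `𝒟`-prime-strips. ([IUTchIII] Prop 1.2 (i) p.31) [claim: Mochizuki2012, status: disputed] -/
theorem inducedD_full (F₁ F₂ : (frame l hl).F) :
    (LogLink.full (logStripData l hl) F₁ F₂).inducedD = PolyIso.full _ _ :=
  LogLink.inducedD_full _ F₁ F₂

end KitsToy

end Literature.IUT.LogThetaLattice

end
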